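import Literature.Topology.FourManifolds.KhResolutionsProofs
import Literature.Topology.FourManifolds.KhResolutionsParityProofs
import HarnessLib

/-!
# Gauss's parity condition implies the merge/split dichotomy

Sibling proof file of `KhResolutions.lean` (topic `Literature/Topology/FourManifolds`), companion of
`KhResolutionsProofs.lean` (the trichotomy merge / split / single-circle bifurcation at a
`0`-smoothed chord, through the *far end* of the walk along the erased resolution) and of
`KhResolutionsParityProofs.lean` (dichotomy ⇒ Gauss parity). Main result:

* `isMergeAt_or_isSplitAt_of_overPos_mod_two_ne` — **if every chord of the Gauss diagram `G`
  joins two marked points of opposite parity (Gauss's parity condition: a closed normal plane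
  curve passes an even number of crossings between its two visits of any crossing,
  C. F. Gauss, *Werke* VIII, pp. 272, 282–286), then at every `0`-smoothed chord of every state
  the flip `0 → 1` is a merge or a split.** Together with
  `overPos_mod_two_ne_of_dichotomy` this makes the conclusion of the named fact
  `isMergeAt_or_isSplitAt_of_hasGaussDiagram` of `KhResolutions` *equivalent* to Gauss's parity
  condition (`dichotomy_iff_overPos_mod_two_ne`), a statement about the diagram of the knot alone;
  the realisability input it still needs is exactly Gauss's theorem that diagrams of closed
  plane curves satisfy the parity condition.

Proof. Walk along the erased resolution of `σ` at chord `i` from the end `(overPos i, out)`,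
i.e. iterate the strand permutation `ρ = restGlue σ i ∘ endFlip` of `KhResolutionsProofs`.
Crossing an arc (`endFlip`) moves from a marked point to a cyclically adjacent one and changes
the parity of the point; a gluing (`endGlue`) moves to the partner point, which under the parity
condition changes the parity again. Hence the parity of the current marked point is invariant
under every step of the walk that is actually glued, and changes under the one stalling step, the
last one, by which the walk reaches chord `i` again (`farEnd`). So the far end lies at a point of
parity opposite to that of `overPos i`, i.e. at `underPos i`
(`farEnd_overPos_fst_eq_underPos`), never at `(overPos i, in)` — the single-circle bifurcation of
`not_reachable_eraseGraph_of_farEnd_eq` is excluded — and the case analysis of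
`isMergeAt_or_isSplitAt_of_reachable_eraseGraph` (which of `σ`, `σ[i ↦ 1]` takes Seifert's
smoothing at `i`, and whether the far end is `(underPos i, in)` or `(underPos i, out)`) exhibits
the edge as a merge or a split.

## References

* O. Viro, *Khovanov homology, its definitions and ramifications*, Fund. Math. 184 (2004)
  317–342, §5.2 (adjacent states of a planar diagram differ by a Morse modification joining two
  circles or splitting one). [cite: Viro2004, §5.2]
* L. H. Kauffman, *Virtual knot theory*, European J. Combin. 20 (1999) 663–690, §2 (Gauss codes,
  the evenly-intersticed / parity condition of Gauss for planar curves). [cite: Kauffman1999, §2]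
* D. Bar-Natan, *On Khovanov's categorification of the Jones polynomial*, Algebr. Geom. Topol. 2
  (2002), §3.1. [cite: BarNatan2002, §3.1]

## Design notes

No definition and no named fact is introduced (D-0026); the file only adds proved lemmas on top of
the `farEnd` machinery of `KhResolutionsProofs`. Parities are phrased as `p.val % 2` on
`Fin (2 * G.n)`, matching `overPos_mod_two_ne_of_dichotomy`.
-/

open Function Set

noncomputable section

namespace Literature.Topology.FourManifolds

namespace GaussDiagram

variable {G : GaussDiagram}

/-! ## Parities of marked points under the elementary moves -/

/-- The cyclic successor changes the parity of a marked point (`2n` is even). [folklore] -/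
theorem succPt_val_mod_two (p : Fin (2 * G.n)) :
    (G.succPt p).val % 2 = (p.val + 1) % 2 := by
  change (p.val + 1) % (2 * G.n) % 2 = _
  exact Nat.mod_mod_of_dvd _ (dvd_mul_right 2 G.n)

/-- The cyclic predecessor changes the parity of a marked point (`2n` is even). [folklore] -/
theorem predPt_val_mod_two (p : Fin (2 * G.n)) :
    (G.predPt p).val % 2 = (p.val + 1) % 2 := by
  have hp := p.isLt
  change (p.val + 2 * G.n - 1) % (2 * G.n) % 2 = _
  rw [Nat.mod_mod_of_dvd _ (dvd_mul_right 2 G.n)]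
  omega

/-- Crossing an arc changes the parity of the marked point of an arc-end. [folklore] -/
theorem endFlip_fst_val_mod_two (e : Fin (2 * G.n) × Bool) :
    (G.endFlip e).1.val % 2 = (e.1.val + 1) % 2 := by
  obtain ⟨p, _ | _⟩ := e
  · exact predPt_val_mod_two p
  · exact succPt_val_mod_two p

/-- **Under Gauss's parity condition the partner of a marked point has the opposite parity.**
[folklore] -/
theorem partner_val_mod_two
    (hpar : ∀ j : Fin G.n, (G.overPos j).val % 2 ≠ (G.underPos j).val % 2) (p : Fin (2 * G.n)) :
    (G.partner p).val % 2 = (p.val + 1) % 2 := by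
  obtain ⟨j, rfl | rfl⟩ := G.exists_chord p
  · rw [partner_overPos]; have := hpar j; omega
  · rw [partner_underPos]; have := hpar j; omega

/-- Under the parity condition every gluing changes the parity of the marked point. [folklore] -/
theorem endGlue_fst_val_mod_two
    (hpar : ∀ j : Fin G.n, (G.overPos j).val % 2 ≠ (G.underPos j).val % 2) (σ : G.State)
    (e : Fin (2 * G.n) × Bool) : (G.endGlue σ e).1.val % 2 = (e.1.val + 1) % 2 := by
  obtain ⟨p, b⟩ := e
  exact partner_val_mod_two hpar p

variable {σ : G.State} {i : Fin G.n} {e₀ : Fin (2 * G.n) × Bool}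

/-- **Invariance.** A step of the strand permutation that is glued (the other end of the arc is
not at chord `i`) preserves the parity of the marked point, under the parity condition.
[folklore] -/
theorem strandPerm_fst_val_mod_two_of_not_isEndAt
    (hpar : ∀ j : Fin G.n, (G.overPos j).val % 2 ≠ (G.underPos j).val % 2)
    {e : Fin (2 * G.n) × Bool} (h : ¬ G.IsEndAt i (G.endFlip e)) :
    (G.strandPerm σ i e).1.val % 2 = e.1.val % 2 := by
  have h1 := endGlue_fst_val_mod_two hpar σ (G.endFlip e)
  have h2 := G.endFlip_fst_val_mod_two e
  rw [strandPerm_apply, restGlue_of_not_isEndAt h]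
  omega

/-- A stalling step of the strand permutation (the other end of the arc lies at chord `i`)
changes the parity of the marked point. [folklore] -/
theorem strandPerm_fst_val_mod_two_of_isEndAt
    {e : Fin (2 * G.n) × Bool} (h : G.IsEndAt i (G.endFlip e)) :
    (G.strandPerm σ i e).1.val % 2 = (e.1.val + 1) % 2 := by
  rw [strandPerm_apply, restGlue_of_isEndAt h, endFlip_fst_val_mod_two]

/-! ## The walk from an end at chord `i` to the far end -/

/-- Strictly between an end `e₀` at chord `i` and the far end of its strand, the walk `ρᵏ e₀`
does not visit chord `i` (the ends at chord `i` on the strand are `e₀` and `ρ^(m/2) e₀` only,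
`eq_self_or_eq_farEnd`). [folklore] -/
theorem not_isEndAt_pow_apply (he₀ : G.IsEndAt i e₀) {j : ℕ} (hj0 : 0 < j)
    (hj : j < MulAction.period (G.strandPerm σ i) e₀ / 2) :
    ¬ G.IsEndAt i ((G.strandPerm σ i ^ j) e₀) := by
  intro hji
  have hmem : (G.strandPerm σ i ^ j) e₀ ∈ G.strand σ i e₀ := ⟨j, by rw [zpow_natCast]⟩
  have h2 := two_mul_half_period (σ := σ) he₀
  rcases eq_self_or_eq_farEnd he₀ hmem hji with h | h
  · have hne := MulAction.pow_smul_ne_of_lt_period (m := G.strandPerm σ i) (a := e₀) (n := j)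
      hj0 (by omega)
    rw [Equiv.Perm.smul_def] at hne
    exact hne h
  · set hp := MulAction.period (G.strandPerm σ i) e₀ / 2 with hhp
    rw [farEnd, ← hhp, zpow_natCast] at h
    have hsplit : G.strandPerm σ i ^ hp = G.strandPerm σ i ^ j * G.strandPerm σ i ^ (hp - j) := by
      rw [← pow_add, Nat.add_sub_cancel' hj.le]
    rw [hsplit, Equiv.Perm.mul_apply] at h
    have hfix : (G.strandPerm σ i ^ (hp - j)) e₀ = e₀ := ((G.strandPerm σ i ^ j).injective h).symm
    have hne := MulAction.pow_smul_ne_of_lt_period (m := G.strandPerm σ i) (a := e₀)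
      (n := hp - j) (by omega) (by omega)
    rw [Equiv.Perm.smul_def] at hne
    exact hne hfix

/-- **The parity of the marked point is constant along the walk up to the last step** (under the
parity condition): every step before the far end is glued. [folklore] -/
theorem pow_apply_fst_val_mod_two
    (hpar : ∀ j : Fin G.n, (G.overPos j).val % 2 ≠ (G.underPos j).val % 2)
    (he₀ : G.IsEndAt i e₀) {k : ℕ} (hk : k < MulAction.period (G.strandPerm σ i) e₀ / 2) :
    ((G.strandPerm σ i ^ k) e₀).1.val % 2 = e₀.1.val % 2 := by
  induction k with
  | zero => simp
  | succ k ih =>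
    have ih' := ih (by omega)
    have hns : ¬ G.IsEndAt i (G.endFlip ((G.strandPerm σ i ^ k) e₀)) := by
      intro hend
      have heq : (G.strandPerm σ i ^ (k + 1)) e₀ = G.endFlip ((G.strandPerm σ i ^ k) e₀) := by
        rw [pow_succ', Equiv.Perm.mul_apply, strandPerm_apply, restGlue_of_isEndAt hend]
      exact not_isEndAt_pow_apply he₀ (Nat.succ_pos k) hk (by rw [heq]; exact hend)
    rw [pow_succ', Equiv.Perm.mul_apply, strandPerm_fst_val_mod_two_of_not_isEndAt hpar hns, ih']

/-- **The far end has the opposite parity** (under the parity condition): the last step of the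
walk stalls at chord `i`. [folklore] -/
theorem farEnd_fst_val_mod_two
    (hpar : ∀ j : Fin G.n, (G.overPos j).val % 2 ≠ (G.underPos j).val % 2)
    (he₀ : G.IsEndAt i e₀) : (G.farEnd σ i e₀).1.val % 2 = (e₀.1.val + 1) % 2 := by
  have h2 := two_mul_half_period (σ := σ) he₀
  have hpos : 0 < MulAction.period (G.strandPerm σ i) e₀ := period_pos
  set hp := MulAction.period (G.strandPerm σ i) e₀ / 2 with hhp
  have hp1 : 1 ≤ hp := by omega
  have hfar : G.farEnd σ i e₀ = G.strandPerm σ i ((G.strandPerm σ i ^ (hp - 1)) e₀) := by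
    rw [farEnd, ← hhp, zpow_natCast, ← Equiv.Perm.mul_apply, ← pow_succ', Nat.sub_add_cancel hp1]
  have hprev := pow_apply_fst_val_mod_two hpar he₀ (σ := σ) (k := hp - 1) (by omega)
  -- the last step stalls: otherwise the far end would not lie at chord `i`
  have hst : G.IsEndAt i (G.endFlip ((G.strandPerm σ i ^ (hp - 1)) e₀)) := by
    by_contra hns
    have h1 : G.IsEndAt i (G.farEnd σ i e₀) := isEndAt_farEnd he₀
    rw [hfar, strandPerm_apply, restGlue_of_not_isEndAt hns, isEndAt_endGlue_iff] at h1
    exact hns h1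
  have hlast := strandPerm_fst_val_mod_two_of_isEndAt (σ := σ) hst
  rw [hfar]
  omega

/-- **Under the parity condition the walk from the over-passage of chord `i` first returns to
chord `i` at the under-passage.** [folklore] -/
theorem farEnd_overPos_fst_eq_underPos
    (hpar : ∀ j : Fin G.n, (G.overPos j).val % 2 ≠ (G.underPos j).val % 2)
    (σ : G.State) (i : Fin G.n) :
    (G.farEnd σ i (G.overPos i, true)).1 = G.underPos i := by
  have he₀ : G.IsEndAt i (G.overPos i, true) := isEndAt_overPos_true
  have hmod := farEnd_fst_val_mod_two (σ := σ) hpar he₀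
  rcases isEndAt_farEnd (σ := σ) he₀ with h | h
  · rw [h] at hmod
    simp only at hmod
    omega
  · exact h

/-! ## Merge or split -/

/-- **Gauss's parity condition implies the merge/split dichotomy.** If every chord of `G` joins
marked points of opposite parity, then at every `0`-smoothed chord `i` of every state `σ` the
edge `σ → σ[i ↦ 1]` of the cube of resolutions is a merge or a split: the far end of the walk
from `(overPos i, out)` is `(underPos i, in)` or `(underPos i, out)`
(`farEnd_overPos_fst_eq_underPos`), and accordingly the state among `σ`, `σ[i ↦ 1]` whose gluing
at `i` realises this far end separates the two local strands
(`circleOf_ne_of_endGlue_eq_farEnd`). Viro (2004), §5.2 (for planar diagrams adjacent states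
differ by a Morse modification joining two circles or splitting one); the parity condition is
Gauss's (Kauffman (1999), §2). [cite: Viro2004, §5.2] -/
theorem isMergeAt_or_isSplitAt_of_overPos_mod_two_ne
    (hpar : ∀ j : Fin G.n, (G.overPos j).val % 2 ≠ (G.underPos j).val % 2)
    (hσ : σ i = false) : G.IsMergeAt σ i ∨ G.IsSplitAt σ i := by
  obtain ⟨b, hb⟩ : ∃ b, G.farEnd σ i (G.overPos i, true) = (G.underPos i, b) :=
    ⟨_, Prod.ext (farEnd_overPos_fst_eq_underPos hpar σ i) rfl⟩
  have hτσ : ∀ e, ¬ G.IsEndAt i e → G.endGlue σ e = G.endGlue σ e := fun _ _ ↦ rfl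
  have hτσ' : ∀ e, ¬ G.IsEndAt i e →
      G.endGlue (Function.update σ i true) e = G.endGlue σ e := fun e he ↦ by
    obtain ⟨ho, hu⟩ := not_or.mp he
    exact G.endGlue_update_of_ne σ true ho hu
  have hS' : G.isSeifert (Function.update σ i true) i = !G.isSeifert σ i :=
    isSeifert_update_true hσ
  cases hS : G.isSeifert σ i <;> cases b
  · -- non-Seifert at `i` in `σ`, far end `(u, in)`: `σ[i ↦ 1]` is Seifert at `i` — a split
    right
    refine ⟨hσ, circleOf_ne_of_endGlue_eq_farEnd (Function.update σ i true) hτσ' ?_⟩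
    simp only [endGlue_overPos_true, hS', hS, hb, Bool.not_false, Bool.not_true]
  · -- non-Seifert at `i` in `σ`, far end `(u, out)`: `σ` — a merge
    left
    refine ⟨hσ, circleOf_ne_of_endGlue_eq_farEnd σ hτσ ?_⟩
    simp only [endGlue_overPos_true, hS, hb, Bool.not_false]
  · -- Seifert at `i` in `σ`, far end `(u, in)`: `σ` — a merge
    left
    refine ⟨hσ, circleOf_ne_of_endGlue_eq_farEnd σ hτσ ?_⟩
    simp only [endGlue_overPos_true, hS, hb, Bool.not_true]
  · -- Seifert at `i` in `σ`, far end `(u, out)`: `σ[i ↦ 1]` — a split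
    right
    refine ⟨hσ, circleOf_ne_of_endGlue_eq_farEnd (Function.update σ i true) hτσ' ?_⟩
    simp only [endGlue_overPos_true, hS', hS, hb, Bool.not_false, Bool.not_true]

/-- **Dichotomy ⇔ parity.** For an arbitrary (possibly virtual) Gauss diagram, every edge of the
cube of resolutions is a merge or a split if and only if every chord joins marked points of
opposite parity (`overPos_mod_two_ne_of_dichotomy` and
`isMergeAt_or_isSplitAt_of_overPos_mod_two_ne`). Viro (2004), §5 (one-to-one bifurcations occur
exactly for non-planar Gauss diagrams violating the parity condition); Kauffman (1999), §2.
[cite: Viro2004, §5] -/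
theorem dichotomy_iff_overPos_mod_two_ne :
    (∀ (σ : G.State) (i : Fin G.n), σ i = false → G.IsMergeAt σ i ∨ G.IsSplitAt σ i) ↔
      ∀ j : Fin G.n, (G.overPos j).val % 2 ≠ (G.underPos j).val % 2 :=
  ⟨overPos_mod_two_ne_of_dichotomy,
    fun hpar _ _ hσ ↦ isMergeAt_or_isSplitAt_of_overPos_mod_two_ne hpar hσ⟩

/-- The named fact `isMergeAt_or_isSplitAt_of_hasGaussDiagram` for `G` follows from Gauss's
parity condition for `G` (no realisability needed for this implication). [folklore] -/
theorem isMergeAt_or_isSplitAt_of_hasGaussDiagram_of_overPos_mod_two_ne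
    (hpar : ∀ j : Fin G.n, (G.overPos j).val % 2 ≠ (G.underPos j).val % 2) :
    isMergeAt_or_isSplitAt_of_hasGaussDiagram (G := G) :=
  fun _ hσ ↦ isMergeAt_or_isSplitAt_of_overPos_mod_two_ne hpar hσ

end GaussDiagram

end Literature.Topology.FourManifolds
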